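import Literature.Claims.NS.Zhong2026
import Literature.Analysis.FluidPDE.NSQuasipotential
import Literature.Analysis.FluidPDE.VorticityCalculus
import Summits.NavierStokesRegularity.NavierStokesRegularity.Theorems.SoloRefuteSantak2026
import HarnessLib

/-!
# C161 `Zhong2026` — refuter of record (ns-claims-refuter-6 g3): `¬ Step_exhaustive`

The typed proof of Theorem 6.2 (`claim_of_printed_steps`, binder `hex`) needs, along EVERY class trajectory
`IsLocalSolution ν T v₀ u p`, the standing hypotheses of the case analysis p.8 l.40–41 — in particular
conjunct 1 of `Step_exhaustive`: «ω ≠ 0 everywhere» at every time `t ∈ [0,T)` (p.4 l.17). At `t = 0` this is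
`NonVanishing (curl v₀)`, which fails for every class datum whose vorticity has a zero — e.g. every datum of
compact support, and the rest state. Kernel objects below:

* `not_Step_exhaustive_of_vorticity_zero` — for every `ν > 0` and every class datum `v₀` (`Chae2007.IsDatum`)
  with `curl v₀ x = 0` at some point, `Step_exhaustive` is false (a class solution from `v₀` exists by the
  tree's DISCHARGED local theory `Chae2007.step_1_holds`);
* `not_Step_exhaustive_datum` — instance: the compactly supported class datum `Chishtie2025.datum ≠ 0` of the
  tree (its vorticity vanishes off a compact set);
* `not_Step_exhaustive` — instance: the rest state `u ≡ 0`, `p ≡ 0` (a class solution for every `ν`, `T`).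

[cite: Zhong2026, proof of Theorem 6.2 p.8 l.40–41, l.47–53; §3.1 p.4 l.17]

WHAT THIS IS NOT: not a claim about NS regularity or blow-up; not a claim about any author beyond the typed locator.
-/

set_option linter.dupNamespace false

namespace Summit.NavierStokesRegularity.NavierStokesRegularity.Theorems.Zhong2026

open Set Filter Topology
open Literature.Analysis.FluidPDE Literature.Claims.NS Literature.Claims.NS.Chae2007
open Literature.Claims.NS.Zhong2026

noncomputable section

/-- The rest state `u ≡ 0`, `p ≡ 0` is a class solution on every slab `[0,T)` from the zero datum
(tree: `isClassicalNSSolutionOn_zero`, `hasBoundedSobolevNormsOn_zero`). [folklore] -/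
theorem isLocalSolution_zero (ν T : ℝ) :
    IsLocalSolution ν T (0 : EuclideanSpace ℝ (Fin 3) → EuclideanSpace ℝ (Fin 3)) (0 : ℝ → EuclideanSpace ℝ (Fin 3) → EuclideanSpace ℝ (Fin 3)) (0 : ℝ → EuclideanSpace ℝ (Fin 3) → ℝ) :=
  ⟨isClassicalNSSolutionOn_zero (Ico 0 T) ν, rfl, fun T'' _ => hasBoundedSobolevNormsOn_zero (Icc 0 T'')⟩

/-- **General form**: for every viscosity `ν > 0` and every class datum whose vorticity has a zero, the
standing hypothesis «ω ≠ 0 everywhere along the trajectory» (conjunct 1 of `Step_exhaustive`) fails at `t = 0`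
on a class solution issued from it (local existence: the tree's `Chae2007.step_1_holds`).
[cite: Zhong2026, proof of Theorem 6.2 p.8 l.40–41; §3.1 p.4 l.17] -/
theorem not_Step_exhaustive_of_vorticity_zero {ν : ℝ} (hν : 0 < ν) {v₀ : EuclideanSpace ℝ (Fin 3) → EuclideanSpace ℝ (Fin 3)} (hv : IsDatum v₀)
    {x : EuclideanSpace ℝ (Fin 3)} (hx : curl v₀ x = 0) : ¬ Step_exhaustive := by
  intro h
  rcases Chae2007.step_1_holds ν hν.le v₀ hv with ⟨u, p, hg⟩ | ⟨T, hT, u, p, hsol, -⟩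
  · have hsol : IsLocalSolution ν 1 v₀ u p := Santak2026.isLocalSolution_of_global 1 hg
    have h1 := (h ν hν 1 one_pos v₀ u p hsol).1 0 ⟨le_rfl, one_pos⟩ x
    rw [hsol.initial] at h1
    exact h1 hx
  · have h1 := (h ν hν T hT v₀ u p hsol).1 0 ⟨le_rfl, hT⟩ x
    rw [hsol.initial] at h1
    exact h1 hx

/-- A compactly supported field has a vorticity zero (its curl has compact support in the non-compact `EuclideanSpace ℝ (Fin 3)`).
[folklore] -/
theorem exists_curl_eq_zero {v : EuclideanSpace ℝ (Fin 3) → EuclideanSpace ℝ (Fin 3)} (hc : HasCompactSupport v) : ∃ x, curl v x = 0 := by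
  have hK : IsCompact (tsupport (curl v)) := hasCompactSupport_curl hc
  obtain ⟨x, hx⟩ : ∃ x, x ∉ tsupport (curl v) := by
    by_contra! h
    exact hK.ne_univ (Set.eq_univ_of_forall h)
  exact ⟨x, (notMem_tsupport_iff_eventuallyEq.mp hx).eq_of_nhds⟩

/-- **Instance with a non-zero datum**: the tree's compactly supported class datum `Chishtie2025.datum`
(`= (1, 0, x₁)` near the origin, `curl(χ A)` globally) has a vorticity zero, so `Step_exhaustive` fails
(at `ν = 1`). [cite: Zhong2026, proof of Theorem 6.2 p.8 l.40–41] -/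
theorem not_Step_exhaustive_datum : ¬ Step_exhaustive := by
  obtain ⟨x, hx⟩ := exists_curl_eq_zero Chishtie2025.hasCompactSupport_datum
  exact not_Step_exhaustive_of_vorticity_zero one_pos Santak2026.isDatum_datum.1 hx

/-- **`¬ Step_exhaustive` (headline)** — witnessed by the rest state: `u ≡ 0`, `p ≡ 0` is a class solution on
`[0,1)` at `ν = 1` whose vorticity vanishes identically, so conjunct 1 («ω ≠ 0 everywhere», p.4 l.17) fails at
`t = 0`, `x = 0`. [cite: Zhong2026, proof of Theorem 6.2 p.8 l.40–41, l.47–53; §3.1 p.4 l.17] -/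
theorem not_Step_exhaustive : ¬ Step_exhaustive := by
  intro h
  have h1 := (h 1 one_pos 1 one_pos _ _ _ (isLocalSolution_zero 1 1)).1 0 ⟨le_rfl, one_pos⟩ 0
  exact h1 (curl_zero 0)

/-- FQN guard: the headline negates the tree decl verbatim. -/
example : ¬ Literature.Claims.NS.Zhong2026.Step_exhaustive := not_Step_exhaustive

end

end Summit.NavierStokesRegularity.NavierStokesRegularity.Theorems.Zhong2026

-- WHAT THIS IS NOT: not a claim about NS regularity or blow-up; not a claim about any author beyond the typed locator.
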